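import Summits.Ventures.CertifiedArithmetic.LowPrec.SRInnerProduct
import HarnessLib

/-!
# FP4 (E2M1) inner products under two-stage SR: the state × product table and all-`n` envelopes

HONEST FRAMING: certified error envelopes and provably optimal rounding/accumulation schemes for
low-precision formats under stated cost models; every table by two implementations; no hardware or
vendor claims.

For `ŝₖ₊₁ = SR(ŝₖ + SR(cₖ))` into E2M1 with `cₖ` ranging over the `37` exact products of two E2M1
values (`e2m1Products`), the one-step accumulated variance (product rounding + expected sum rounding)
from a representable state `s` is a finite STATE × PRODUCT TABLE of `15 · 37 = 555` entries; the
kernel decides its maximum `3/2` (`ip_table_le`, attained at `s = -1`, `c = -9/2`: `ip_table_witness`).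
Consequences for EVERY stream of products and EVERY `n` (theorems, no enumeration):
`ipVar ≤ (3/2)·n` (`fp4_ipVar_le`) and, without a saturating branch,
`P(|ŝₙ − ∑ cₖ| ≥ t) ≤ 3n/(2t²)` (`fp4_ip_prob_dev_ge_le`).  The generic engine `ipVar_le_of_mem` is
format-free.  Two independent Python enumerators (certs/sr, keys `ip_*`) reproduce the exact laws for
`n ≤ 3` and agree with the kernel values of `SRInnerProduct` (`E ŝ₃ = -9/4`, `Var = 9/16` on
`(9/4, 3/2, -6)`).
-/

namespace Summit.Ventures.CertifiedArithmetic.LowPrec.SR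

open Literature.ComputerArithmetic.ConnollyHighamMary2021
open Finset

variable {K : Type*} [Field K] [LinearOrder K] [IsStrictOrderedRing K]

/-- **Inner-product variance from a state × product table.** If from every representable state `s`
and for every admissible product `c` the one-step quantity
`v_F(c̄) + E[v_F(s + SR(c))]` is `≤ V`, then for every stream of admissible products and every `n`,
`ipVar ≤ n·V` (all intermediate states are representable). -/
theorem ipVar_le_of_mem {F : Finset K} (hF : F.Nonempty) (P : Finset K) (V : K)
    (hV : ∀ s ∈ F, ∀ c ∈ P,
      srVar F (clamp F c) + step F c (fun a => srVar F (clamp F (s + a))) ≤ V) :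
    ∀ (n : ℕ) (c : ℕ → K) (s : K), s ∈ F → (∀ i, c i ∈ P) → ipVar F c n s ≤ n * V := by
  intro n
  induction n with
  | zero => intro c s _ _; simp [ipVar]
  | succ n ih =>
      intro c s hs hc
      simp only [ipVar, ipStep]
      have h1 := hV s hs (c 0) (hc 0)
      have h2 : step F (c 0) (fun a => step F (s + a) (ipVar F (fun i => c (i + 1)) n)) ≤ n * V :=
        step_le_of F _
          (step_le_of F _ (ih _ _ (up_mem hF _) (fun i => hc (i + 1)))
            (ih _ _ (dn_mem hF _) (fun i => hc (i + 1))))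
          (step_le_of F _ (ih _ _ (up_mem hF _) (fun i => hc (i + 1)))
            (ih _ _ (dn_mem hF _) (fun i => hc (i + 1))))
      push_cast
      linarith

/-- Chebyshev envelope from a state × product table: without a saturating branch,
`P(|ŝₙ − (s + ∑ cₖ)| ≥ t) ≤ n V / t²`. -/
theorem ip_prob_dev_ge_le_of_mem {F : Finset K} (hF : F.Nonempty) (P : Finset K) (V : K)
    (hV : ∀ s ∈ F, ∀ c ∈ P,
      srVar F (clamp F c) + step F c (fun a => srVar F (clamp F (s + a))) ≤ V)
    (c : ℕ → K) (n : ℕ) (s : K) (hs : s ∈ F) (hc : ∀ i, c i ∈ P) (h : IPNoSat F c n s)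
    {t : K} (ht : 0 < t) :
    ipExp F c n (devInd t (s + ∑ k ∈ range n, c k)) s ≤ n * V / t ^ 2 :=
  (ipExp_prob_dev_ge_le_ipVar F c n s h ht).trans
    (div_le_div_of_nonneg_right (ipVar_le_of_mem hF P V hV n c s hs hc) (pow_pos ht 2).le)

end Summit.Ventures.CertifiedArithmetic.LowPrec.SR

namespace Summit.Ventures.CertifiedArithmetic.LowPrec.SR.FP4

open Literature.ComputerArithmetic.ConnollyHighamMary2021
open Summit.Ventures.CertifiedArithmetic.LowPrec.SR
open Finset

/-- The exact products of two E2M1 values. -/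
def e2m1Products : Finset ℚ := (e2m1 ×ˢ e2m1).image (fun p => p.1 * p.2)

/-- There are `37` distinct products of two E2M1 values (both enumerators report `nproducts = 37`). -/
theorem e2m1Products_card : e2m1Products.card = 37 := by decide +kernel

/-- Membership: a product of two E2M1 values is in `e2m1Products`. -/
theorem mul_mem_e2m1Products {x y : ℚ} (hx : x ∈ e2m1) (hy : y ∈ e2m1) : x * y ∈ e2m1Products :=
  Finset.mem_image.mpr ⟨(x, y), Finset.mem_product.mpr ⟨hx, hy⟩, rfl⟩

/-- **STATE × PRODUCT TABLE (555 entries, kernel decision).** From every E2M1 state and for every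
product of two E2M1 values, the one-step inner-product variance is `≤ 3/2`. -/
theorem ip_table_le : ∀ s ∈ e2m1, ∀ c ∈ e2m1Products,
    srVar e2m1 (clamp e2m1 c) + step e2m1 c (fun a => srVar e2m1 (clamp e2m1 (s + a))) ≤ 3/2 := by
  decide +kernel

/-- The table bound `3/2` is attained at `s = -1`, `c = -9/2 = (-3/2)·3`. -/
theorem ip_table_witness :
    srVar e2m1 (clamp e2m1 (-9/2 : ℚ)) + step e2m1 (-9/2 : ℚ)
      (fun a => srVar e2m1 (clamp e2m1 ((-1 : ℚ) + a))) = 3/2 := by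
  decide +kernel

/-- **FP4 inner-product variance growth.** For every stream `cₖ = xₖ yₖ` of products of E2M1 values,
every representable start and every `n`: `ipVar ≤ (3/2)·n`. -/
theorem fp4_ipVar_le (c : ℕ → ℚ) (hc : ∀ i, c i ∈ e2m1Products) (n : ℕ) (s : ℚ) (hs : s ∈ e2m1) :
    ipVar e2m1 c n s ≤ n * (3/2) :=
  ipVar_le_of_mem e2m1_nonempty e2m1Products (3/2) ip_table_le n c s hs hc

/-- The same for streams given as pairs of E2M1 vectors. -/
theorem fp4_ipVar_le' (x y : ℕ → ℚ) (hx : ∀ i, x i ∈ e2m1) (hy : ∀ i, y i ∈ e2m1) (n : ℕ) :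
    ipVar e2m1 (fun i => x i * y i) n 0 ≤ n * (3/2) :=
  fp4_ipVar_le _ (fun i => mul_mem_e2m1Products (hx i) (hy i)) n 0 zero_mem_e2m1

/-- **FP4 inner-product √n law.** For E2M1 vectors `x, y`, every `n` and `t > 0`, if no branch
saturates then `P(|ŝₙ − ∑ xₖyₖ| ≥ t) ≤ 3n/(2t²)`. -/
theorem fp4_ip_prob_dev_ge_le (x y : ℕ → ℚ) (hx : ∀ i, x i ∈ e2m1) (hy : ∀ i, y i ∈ e2m1) (n : ℕ)
    (h : IPNoSat e2m1 (fun i => x i * y i) n 0) {t : ℚ} (ht : 0 < t) :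
    ipExp e2m1 (fun i => x i * y i) n (devInd t (∑ k ∈ range n, x k * y k)) 0 ≤ n * (3/2) / t ^ 2 := by
  have := ip_prob_dev_ge_le_of_mem e2m1_nonempty e2m1Products (3/2) ip_table_le
    (fun i => x i * y i) n 0 zero_mem_e2m1 (fun i => mul_mem_e2m1Products (hx i) (hy i)) h ht
  simpa using this

/-- Slack of the all-`n` bound at `n = 2`: the exhaustive two-implementation table (certs/sr
`ip_ocp_e2m1_n2`) has maximal no-saturation variance `3/2 = (3/4)·2` at `c = (-9/2, 9/2)`; kernel value. -/
theorem ip_pair_var_witness : ipVar e2m1 (seq3 (-9/2) (9/2) 0) 2 0 = 3/2 := by decide +kernel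

end Summit.Ventures.CertifiedArithmetic.LowPrec.SR.FP4
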